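import Summits.BirchSwinnertonDyer.BirchSwinnertonDyer.Theorems.ErratumRoadFiveNonSurjCornerBranchesAn
import Summits.BirchSwinnertonDyer.BirchSwinnertonDyer.Theorems.ErratumRoadFiveNonSurjCornerBranches
import Summits.BirchSwinnertonDyer.Rank1Residual.X11a.MuLambdaSplit
import Literature.NumberTheory.EllipticCurves.LeadingTermPPartProofs
import Literature.NumberTheory.EllipticCurves.PAdicBSDSplitMultiplicativeProofs
import Literature.NumberTheory.EllipticCurves.PAdicLFunctionNonsplitMultiplicativeExistenceProofs
import HarnessLib

/-!
# Route `ErratumRoadFive` (rung K2), crux 6 `NonSurjCorner` (item stmt-BirchSwinnertonDyer-19065), the twin summand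
# BY NAME from the X11a LANE CERTIFICATE: `X11a.MuAnZeroAt W p ⟹ μ(X(E/ℚ_∞)) = 0` at a non-surjective multiplicative
# pair, hence `NonSurjCornerTwinMu ⟸ (∀ leaf twins, X11a.MuAnZeroAt)`, and the third glue variant
# (cell `bsd-stepL`, seat `bsd-stepL-corner-p1` g6; `--supports stmt-BirchSwinnertonDyer-19065`)

Corner-p1 g5's NEXT (2): «@K6: `KatoMuTransfer` at p ∥ N + the lane certificate `X11a.MuAnZeroAt` at the twins would
discharge the twin conjunct by name». The transfer at `p ∥ N` is this seat's `X11b.MultMu.mu_eq_zero_of_multFine`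
(p487898); `X11a.MuAnZeroAt W p` (b2b x11a gen 14, `X11a/MuLambdaSplit.lean`) is the X11a lane's per-pair certificate
«μ^an(E,p) = 0» in the Néron normalisation (for every newform `f` and `ϖ` with `ϖ·Ω_E = Ω⁺_f`, a unit coefficient
of `ϖ·L_p`, the non-split resp. split MTT function). This file composes them:

* §1 `MultMu.mu_eq_zero_of_muAnZeroAt` — `X11a.MuAnZeroAt W p → (∀ cyclotomic D, D.mu = 0)` for `p` odd multiplicative,
  `E[p]` irreducible, `ρ̄` NOT onto, modulo F1-mult (`Kato2004.exists_multDivisibilityInputs_fine`), Wuthrich Cor. 18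
  and the parametrisation supply `nonempty_modularParametrizationData` (which yields a newform `Dm.f` and a RATIONAL
  period ratio `ϖ`, `ModularParametrizationData.exists_rat_mul_realPeriodRat_eq_plusPeriod`; the MTT functions exist by
  the tree theorems `exists_isSplitMultPAdicLFunctionOf` ∕ `exists_isMultPAdicLFunctionOf_neg_one_of_nonsplit`).
* §2 `twinMu_of_laneCertificates` — **`Theorems.NonSurjCornerTwinMu` (the literal child, Greenberg's μ = 0 at the
  leaf twins) from `∀ leaf twins, X11a.MuAnZeroAt Wd p`** + the three facts; and `twinMuAn_iff…`-free: the analytic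
  child `NonSurjCornerTwinMuAn` implies the lane certificate at the twins (`laneCertificates_of_twinMuAn`), so both
  analytic texts feed the literal child.
* §4 `X11b.multDivisibilityAt_of_katoFacts_of_muAnZeroAt` — for the X11a lane's NON-surjective leaf at `p ∥ N`: the pair's own
  lane certificate gives x11c's `MultDivisibilityAt W p` (no `μ = 0` hypothesis, no CM partner ∕ EPW transport).
* §3 `nonSurjCorner_of_branchesLane` — the glue with the lane-certificate text as third child: Zₚᶜ → Jₚᶜ →
  (∀ leaf twins, `X11a.MuAnZeroAt Wd p`) → ⟨KatoTwinFactsFiveAn⟩ → X11aLowerHalf → NonSurjCorner (via §2 and the glue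
  of record `nonSurjCorner_of_branches`).

HONEST FRAMING: theorems only; CONDITIONAL on the displayed named facts ∕ shapes; nothing asserted about any curve;
nothing booked; item 19065 does not close; BSD is not advanced; no census word moves (T7).

References: [Kato2004Asterisque] Thm. 12.6, (14.9.3), §17.13; [Wuthrich2014] Cor. 18; [GreenbergLNM1716] Conj. 1.11;
[GreenbergVatsal2000] p. 2–4 (μ_an; shape); [EdixhovenManin1991] §1 (ϖ ∈ ℚ); [MazurTateTeitelbaum1986] §I.10, §I.14.
-/

set_option autoImplicit false
set_option linter.dupNamespace false

noncomputable section

open scoped Classical NumberField MatrixGroups ModularForm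

namespace Summit.BirchSwinnertonDyer.Rank1Residual.X11b.MultMu

open CongruenceSubgroup WeierstrassCurve NumberField IsDedekindDomain Field
  Literature.NumberTheory.EllipticCurves
  Literature.NumberTheory.EllipticCurves.ModularForms
  Literature.NumberTheory.EllipticCurves.Rank1Residual
  Literature.NumberTheory.EllipticCurves.Kato2004
  Summit.BirchSwinnertonDyer.Rank1Residual

/-! ### §1 The lane certificate discharges Greenberg's `μ = 0` at a non-surjective multiplicative pair -/

/-- **`X11a.MuAnZeroAt W p ⟹ μ(X(E/ℚ_∞)) = 0`** for `W` globally minimal, `p` an ODD prime of MULTIPLICATIVE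
reduction, `E[p]` irreducible and `ρ̄_{E,p}` NOT onto — modulo F1-mult (`hfine`), Wuthrich 2014 Cor. 18 (`h18`) and the
modular parametrisation supply (`hpar`). The certificate is used at ONE newform ∕ period ratio ∕ MTT function:
`Dm.f`, the rational `ϖ` of `exists_rat_mul_realPeriodRat_eq_plusPeriod`, and the split resp. non-split function of
the tree's existence theorems; then `mu_eq_zero_of_multFine`. [cite: Kato2004Asterisque, Thm. 12.6 (p. 222) and §17.13 (pp. 279–280)]
[cite: Wuthrich2014, Cor. 18 (p. 398)] [cite: EdixhovenManin1991, §1 (the period ratio is rational)]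
[cite: GreenbergLNM1716, §1 Conj. 1.11 (the conclusion's shape)] -/
theorem mu_eq_zero_of_muAnZeroAt (hfine : exists_multDivisibilityInputs_fine)
    (h18 : Wuthrich2014.corollary18_padicLFunction_mem_iwasawaAlgebra_multiplicative)
    (hpar : nonempty_modularParametrizationData)
    (W : WeierstrassCurve ℚ) [W.IsElliptic] [W.IsGloballyMinimal] (p : ℕ) [Fact p.Prime]
    (hp : p ≠ 2) (hmult : W.HasMultiplicativeReductionAtPrime p) (hirr : W.HasIrreducibleModPGaloisRep p)
    (hnsurj : ¬ W.HasSurjectiveModNGaloisRep p) (hA : X11a.MuAnZeroAt W p) :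
    ∀ (κ : ZpExtension ℚ p) (γ : absoluteGaloisGroup ℚ),
      κ.IsCyclotomic → κ.IsTopGenerator γ → IsCyclotomicVariable p γ →
      ∀ D : W.SelmerDualData κ γ, D.mu = 0 := by
  intro κ γ hκ hγ hγ' D
  haveI : NeZero (W.conductorNorm ℤ) := ⟨(W.conductorNorm_pos_holds).ne'⟩
  obtain ⟨Dm⟩ := hpar W
  obtain ⟨ϖ, -, hϖ, -⟩ := Dm.exists_rat_mul_realPeriodRat_eq_plusPeriod
  obtain ⟨hAns, hAs⟩ := hA Dm.f Dm.isNewformOf ϖ hϖ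
  by_cases hsplit : W.HasSplitMultiplicativeReductionAtPrime p
  · obtain ⟨L, hL⟩ := exists_isSplitMultPAdicLFunctionOf hsplit Dm.isNewformOf
    exact mu_eq_zero_of_multFine hfine h18 W p Dm.f hp hmult hirr hnsurj Dm.isNewformOf ϖ hϖ 1 L
      (fun _ => rfl) (fun hns => absurd hsplit hns) ((isMultPAdicLFunctionOf_one_iff L).mpr hL)
      (hAs hsplit L hL) κ γ hκ hγ hγ' D
  · obtain ⟨L, hL⟩ := exists_isMultPAdicLFunctionOf_neg_one_of_nonsplit Dm.isNewformOf hmult hsplit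
    exact mu_eq_zero_of_multFine hfine h18 W p Dm.f hp hmult hirr hnsurj Dm.isNewformOf ϖ hϖ (-1) L
      (fun hs => absurd hs hsplit) (fun _ => rfl) hL (hAns hsplit L hL) κ γ hκ hγ hγ' D

end Summit.BirchSwinnertonDyer.Rank1Residual.X11b.MultMu

namespace Summit.BirchSwinnertonDyer.BirchSwinnertonDyer.Theorems

open CongruenceSubgroup WeierstrassCurve NumberField IsDedekindDomain Field
  Literature.NumberTheory.EllipticCurves
  Literature.NumberTheory.EllipticCurves.ModularForms
  Literature.NumberTheory.EllipticCurves.Rank1Residual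
  Literature.NumberTheory.EllipticCurves.Rank1Residual.Typed
  Literature.NumberTheory.EllipticCurves.Wuthrich2014
  Literature.NumberTheory.EllipticCurves.SteinWuthrich2013
  Literature.NumberTheory.EllipticCurves.Greenberg1999
  Literature.NumberTheory.EllipticCurves.Kato2004
  Literature.NumberTheory.QuadraticFields.Quadratic
  Summit.BirchSwinnertonDyer.Rank1Residual
  Summit.BirchSwinnertonDyer.Rank1Residual.X11b
  Summit.BirchSwinnertonDyer.Rank1Residual.X11b.Three.Koly

/-! ### §2 The literal child from the lane certificates at the leaf twins -/

/-- **`NonSurjCornerTwinMu` (Greenberg's `μ = 0` at the non-surjective X11a leaf twins, the LITERAL child, BY NAME)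
from the X11a LANE CERTIFICATE at every such twin** (`∀ Wd p, ClassX11a Wd p → ¬Surj → p ∈ {5,7} → p ∣ ord_p Δ_min →
X11a.MuAnZeroAt Wd p`) and three named facts (F1-mult, Wuthrich Cor. 18, parametrisation supply). `ClassX11a` gives
`p ≠ 2`, `Mult`, `Irr`. CONDITIONAL; nothing booked. [cite: GreenbergLNM1716, §1 Conj. 1.11 (p. 61)]
[cite: Kato2004Asterisque, §17.13 (pp. 279–280)] [cite: Wuthrich2014, Cor. 18 (p. 398)] -/
theorem twinMu_of_laneCertificates (hfine : Kato2004.exists_multDivisibilityInputs_fine)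
    (h18 : Wuthrich2014.corollary18_padicLFunction_mem_iwasawaAlgebra_multiplicative)
    (hpar : nonempty_modularParametrizationData)
    (hLane : ∀ (Wd : WeierstrassCurve ℚ) [Wd.IsElliptic] [Wd.IsGloballyMinimal] (p : ℕ) [Fact p.Prime],
      ClassX11a Wd p → ¬ Surj Wd p → (p = 5 ∨ p = 7) → p ∣ padicValInt p Wd.minimalDiscriminantInt →
      X11a.MuAnZeroAt Wd p) :
    NonSurjCornerTwinMu := by
  intro Wd _ _ p _ hXa hns h57 hv κ γ hκ hγ hγ' D
  exact MultMu.mu_eq_zero_of_muAnZeroAt hfine h18 hpar Wd p hXa.2.1 hXa.2.2.1 hXa.2.2.2.1 hns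
    (hLane Wd p hXa hns h57 hv) κ γ hκ hγ hγ' D

/-- **The analytic child `NonSurjCornerTwinMuAn` implies the lane certificate at every leaf twin** (its text quantifies
the same unit-coefficient statement over `a = ±1` with `IsMultPAdicLFunctionOf f p a L`; at a split `p` the split
function is `IsMultPAdicLFunctionOf f p 1` by `isMultPAdicLFunctionOf_one_iff`). Bookkeeping only. [folklore] -/
theorem laneCertificates_of_twinMuAn (hμ : NonSurjCornerTwinMuAn) :
    ∀ (Wd : WeierstrassCurve ℚ) [Wd.IsElliptic] [Wd.IsGloballyMinimal] (p : ℕ) [Fact p.Prime],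
      ClassX11a Wd p → ¬ Surj Wd p → (p = 5 ∨ p = 7) → p ∣ padicValInt p Wd.minimalDiscriminantInt →
      X11a.MuAnZeroAt Wd p := by
  intro Wd _ _ p _ hXa hns h57 hv N _ f hf ϖ hϖ
  refine ⟨fun hnsp L hL => ?_, fun hsp L hL => ?_⟩
  · exact hμ Wd p hXa hns h57 hv f hf ϖ hϖ (-1) L (fun hs => absurd hs hnsp) (fun _ => rfl) hL
  · exact hμ Wd p hXa hns h57 hv f hf ϖ hϖ 1 L (fun _ => rfl) (fun hns' => absurd hsp hns')
      ((isMultPAdicLFunctionOf_one_iff L).mpr hL)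

/-- **The literal child from the analytic child**: `NonSurjCornerTwinMuAn → NonSurjCornerTwinMu` modulo F1-mult,
Wuthrich Cor. 18 and the parametrisation supply (§1 ∘ `laneCertificates_of_twinMuAn`). So the split with the analytic
child is at least as strong as the split of record. CONDITIONAL; nothing booked.
[cite: GreenbergLNM1716, §1 Conj. 1.11 (p. 61)] [cite: Kato2004Asterisque, §17.13 (pp. 279–280)] -/
theorem twinMu_of_twinMuAn (hfine : Kato2004.exists_multDivisibilityInputs_fine)
    (h18 : Wuthrich2014.corollary18_padicLFunction_mem_iwasawaAlgebra_multiplicative)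
    (hpar : nonempty_modularParametrizationData) (hμ : NonSurjCornerTwinMuAn) : NonSurjCornerTwinMu :=
  twinMu_of_laneCertificates hfine h18 hpar (laneCertificates_of_twinMuAn hμ)

/-! ### §3 The glue with the lane-certificate text as the third child -/

/-- **GLUE VARIANT (lane text): Zₚᶜ → Jₚᶜ → (∀ leaf twins, `X11a.MuAnZeroAt Wd p`) → `KatoTwinFactsFiveAn` →
`X11aLowerHalf` → `NonSurjCorner`** — the glue of record `nonSurjCorner_of_branches` with its TwinMu binder supplied
by §2 (`nonempty_modularParametrizationData` is conjunct 7 of the bundle, F1-mult conjunct 23). CONDITIONAL; closes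
nothing by itself. [cite: Cha2005, Thm. 21 and Rmk. 25 (pp. 173–175)] [cite: Kato2004Asterisque, §17.13 (pp. 279–280)]
[cite: GreenbergLNM1716, §1 Conj. 1.11 (shape)] -/
theorem nonSurjCorner_of_branchesLane (hZ : NonSurjCornerKolyZ) (hJ : NonSurjCornerKolyJ)
    (hLane : ∀ (Wd : WeierstrassCurve ℚ) [Wd.IsElliptic] [Wd.IsGloballyMinimal] (p : ℕ) [Fact p.Prime],
      ClassX11a Wd p → ¬ Surj Wd p → (p = 5 ∨ p = 7) → p ∣ padicValInt p Wd.minimalDiscriminantInt →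
      X11a.MuAnZeroAt Wd p)
    (hF :
      (∀ (N : ℕ) [NeZero N] (W : WeierstrassCurve ℚ) (K : Type) [Field K] [NumberField K], gross_zagier N W K) ∧
      (∀ (N : ℕ) [NeZero N] (W : WeierstrassCurve ℚ) (K : Type) [Field K] [NumberField K], kolyvagin N W K) ∧
      sha_dvd_analyticSha ∧
      rank_eq_analyticRank_of_analyticRank_le_one ∧
      WeierstrassCurve.hasEntireLFunction_rat ∧
      exists_isNewformOf ∧
      nonempty_modularParametrizationData ∧
      friedbergHoffstein_exists_heegnerField_split_twist_ne_zero ∧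
      mazur_not_dvd_maninConstant_of_odd ∧
      (∀ (N : ℕ) [NeZero N] (W : WeierstrassCurve ℚ) (K : Type) [Field K] [NumberField K],
        heegnerPointOfConductor_one_galoisConj N W K) ∧
      (∀ (N : ℕ) [NeZero N] (W : WeierstrassCurve ℚ) (K : Type) [Field K] [NumberField K],
        phi_heegnerTau_mem_singularModuliField N W K) ∧
      thm61_splitMultiplicative ∧
      thm61_nonsplitMultiplicative ∧
      (∀ (W : WeierstrassCurve ℚ) [W.IsElliptic] [W.IsGloballyMinimal] (p : ℕ) [Fact p.Prime],
        greenberg_stevens (W := W) (p := p)) ∧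
      Cha2005.rmk25_pow_dvd_card_sha_primary_of_certificate ∧
      Cha2005.rmk25_padicValNat_card_sha_primary_add_le_of_globalDivisibility ∧
      Kato2004.nonempty_iwasawaH1Data ∧
      Kato2004.thm12_4 ∧
      Kato2004.exists_multDivisibilityInputs_nonsplit ∧
      Kato2004.exists_multDivisibilityInputs_split ∧
      thm15_isTorsion_multiplicative_rat ∧
      Wuthrich2014.corollary18_padicLFunction_mem_iwasawaAlgebra_multiplicative ∧
      Kato2004.exists_multDivisibilityInputs_fine)
    (h₄ : Summit.BirchSwinnertonDyer.BirchSwinnertonDyer.Theses.ErratumRoadFive.X11aLowerHalf) :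
    Summit.BirchSwinnertonDyer.BirchSwinnertonDyer.Theses.ErratumRoadFive.NonSurjCorner := by
  obtain ⟨hGZ, hKo, hWu, hGZK, hmod, hnf, hpar, hFHs, hMaz, hrec, hD36, hJs, hJn, hGS, hChaL, hChaU, hne, h12,
    hns, hsp, h15, h18, hfine⟩ := hF
  exact nonSurjCorner_of_branches hZ hJ (twinMu_of_laneCertificates hfine h18 hpar hLane)
    ⟨hGZ, hKo, hWu, hGZK, hmod, hnf, hpar, hFHs, hMaz, hrec, hD36, hJs, hJn, hGS, hChaL, hChaU, hne, h12, hns, hsp,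
      h15, h18⟩ h₄

end Summit.BirchSwinnertonDyer.BirchSwinnertonDyer.Theorems

namespace Summit.BirchSwinnertonDyer.Rank1Residual.X11b

open CongruenceSubgroup WeierstrassCurve NumberField IsDedekindDomain Field
  Literature.NumberTheory.EllipticCurves
  Literature.NumberTheory.EllipticCurves.ModularForms
  Literature.NumberTheory.EllipticCurves.Rank1Residual
  Literature.NumberTheory.EllipticCurves.Rank1Residual.Typed
  Literature.NumberTheory.EllipticCurves.Wuthrich2014
  Literature.NumberTheory.EllipticCurves.SteinWuthrich2013
  Literature.NumberTheory.EllipticCurves.Greenberg1999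
  Literature.NumberTheory.EllipticCurves.Kato2004
  Summit.BirchSwinnertonDyer.Rank1Residual

/-! ### §4 For the X11a lane (non-surjective leaf at `p ∥ N`): the lane certificate gives x11c's typed divisibility -/

/-- **`X11a.MuAnZeroAt W p ⟹ X11b.MultDivisibilityAt W p` at an odd multiplicative pair with `E[p]` irreducible and
`ρ̄` NOT onto**, modulo the six Kato∕Greenberg∕Wuthrich facts and F1-mult — the pair's OWN analytic certificate replaces
both `μ = 0` and any CM-partner ∕ Emerton–Pollack–Weston transport (`X11a/NonSurjectiveLeaf.lean`'s roads): unpack the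
lane certificate into the `a = ±1` form and apply `multDivisibilityAt_of_katoFacts_of_muAn` (p488499). With
`missingUpperBoundAt_of_multDivisibilityAt_of_analyticRank_eq_zero` this is the Kato half `Typed.MissingUpperBoundAt`
of every rank-0 non-surjective multiplicative pair carrying a `μ_an = 0` certificate. CONDITIONAL on the named facts;
nothing booked. [cite: Kato2004Asterisque, Thm. 12.4 (p. 221), Thm. 12.6 (p. 222) and §17.13 (pp. 279–280)]
[cite: Wuthrich2014, Cor. 18 (p. 398)] [cite: GreenbergLNM1716, Thm. 1.5 (p. 61)] -/
theorem multDivisibilityAt_of_katoFacts_of_muAnZeroAt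
    (hne : Kato2004.nonempty_iwasawaH1Data) (h12 : Kato2004.thm12_4)
    (hns : Kato2004.exists_multDivisibilityInputs_nonsplit)
    (hsp : Kato2004.exists_multDivisibilityInputs_split)
    (h15 : thm15_isTorsion_multiplicative_rat)
    (h18 : Wuthrich2014.corollary18_padicLFunction_mem_iwasawaAlgebra_multiplicative)
    (hfine : Kato2004.exists_multDivisibilityInputs_fine)
    (W : WeierstrassCurve ℚ) [W.IsElliptic] [W.IsGloballyMinimal] (p : ℕ) [Fact p.Prime]
    (hp : p ≠ 2) (hmult : Mult W p) (hirr : Irr W p) (hnsurj : ¬ Surj W p) (hA : X11a.MuAnZeroAt W p) :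
    MultDivisibilityAt W p :=
  multDivisibilityAt_of_katoFacts_of_muAn hne h12 hns hsp h15 h18 hfine W p hp hmult hirr hnsurj
    (fun f hf ϖ hϖ a L hsa hna hL => by
      obtain ⟨hAns, hAs⟩ := hA f hf ϖ hϖ
      by_cases hsplit : W.HasSplitMultiplicativeReductionAtPrime p
      · have ha : a = 1 := hsa hsplit
        subst ha
        exact hAs hsplit L ((isMultPAdicLFunctionOf_one_iff L).mp hL)
      · have ha : a = -1 := hna hsplit
        subst ha
        exact hAns hsplit L hL)

end Summit.BirchSwinnertonDyer.Rank1Residual.X11b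

end
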